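import Summits.AtomisticToContinuum.HydrodynamicLimit.Theorems.RelayRaceLocalityConeLocalisationElevatorDefs
import Literature.MathematicalPhysics.KineticTheory.HardSphereEulerProofs
import Literature.MathematicalPhysics.KineticTheory.HardSphereCanonicalTorus
import HarnessLib

/-!
# RelayRaceLocality · ConeLocalisation — line `einstein-elevator`, stub `stub_transfer`

Support file for the crux item `stmt-AtomisticToContinuum-12504` (`ConeLocalisation`, route RelayRaceLocality of
`AtomisticToContinuum/HydrodynamicLimit`), line lead a1 (prover-line-stmt-AtomisticToContinuum-12504-a1-0,
2026-08-17), proving the registered stub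

  `stub_transfer : ElevatorOrbitHL → DynamicNearAtmosphere → ShortTimeGuardedHL`

of the skeleton v1 of the line `einstein-elevator` (`Cruxes/ConeLocalisation/Lines/EinsteinElevatorSketch.lean`; Props in
`Theorems/RelayRaceLocalityConeLocalisationElevatorDefs.lean`, p143529). It is pure quantifier bookkeeping against the
UNFLOORED short-time guarded hydrodynamic limit `S = ShortTimeGuardedHL` (verbatim the consequent of the crux):

* `η₀ := min η₀ᴱ η₁` (the packing bands of the two inputs);
* level `M < 1`: the temperature guard `θ ≤ M ∧ M⁻¹ ≤ θ` is unsatisfiable, the clause is vacuous;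
* level `M ≥ 1`: natural horizon `Θ := C Mᵃ + 1`, then `K, δ` from `ElevatorOrbitHL`, then `τ` from
  `DynamicNearAtmosphere`, `τ₁ := min τ (C Mᵃ / (4 K))`; after the profile `σ₀ := min σ₀ᴱ (1/2)`
  (`isProbabilityMeasure_localGibbsLaw` needs `σ ≤ 1/2`, `DynamicNearAtmosphere` needs `σ ≤ 1`);
* at `0 < t < min T τ₁`: scale `ℓ₀ := t / (C Mᵃ)` (so `K ℓ₀ ≤ 1/4`, `ℓ₀ ≤ 1`, `t < Θ ℓ₀`), the conjunct's own family
  `(hsDiameter σ N, N + 1)` (so the laws of `ElevatorOrbitHL` ARE `localGibbsLaw σ a₀ u₀ θ₀ N (Φ N)` by `rfl`), the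
  near-atmosphere hypothesis from `DynamicNearAtmosphere`, and `GuardAt ⇒ GuardAtScale ℓ₀` (`guardAtScale_of_guardAt`).

The two antecedents `LightConeInLaw`, `NearConstantShortTimeHL` of the crux are not used: the global
`ElevatorOrbitHL` applied to the conjunct's own family already localises.
-/

noncomputable section

namespace Summit.AtomisticToContinuum.HydrodynamicLimit.Theorems.ConeLocalisation.Elevator

open scoped Topology
open Filter Set MeasureTheory
open Literature.MathematicalPhysics.KineticTheory Literature.Analysis.FluidPDE
  Literature.Analysis.FunctionSpaces
open Summit.AtomisticToContinuum.HydrodynamicLimit.Theses.RelayRaceLocality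

/-- For `0 < M < 1` the level-`M` guards of `S` are unsatisfiable (`θ ≤ M < 1 < M⁻¹ ≤ θ`). [folklore] -/
theorem not_guardAt_of_lt_one {η M σ : ℝ} {ρ θ : ℝ → T3 → ℝ} {u : ℝ → T3 → V3} {s : ℝ} {x : T3}
    (hM : 0 < M) (hM1 : M < 1) : ¬ GuardAt η M σ ρ θ u s x := by
  rintro ⟨-, -, h3, h4, -⟩
  have : (1 : ℝ) < M⁻¹ := one_lt_inv_iff₀.2 ⟨hM, hM1⟩
  linarith

/-- Along the conjunct's family the reduced density is constant: `(N + 1) · hsDiameter σ N ³ → σ³`. [folklore] -/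
theorem tendsto_succ_mul_hsDiameter_pow_three (σ : ℝ) :
    Tendsto (fun N : ℕ => ((N + 1 : ℕ) : ℝ) * hsDiameter σ N ^ 3) atTop (nhds (σ ^ 3)) := by
  have h : (fun N : ℕ => ((N + 1 : ℕ) : ℝ) * hsDiameter σ N ^ 3) = fun _ => σ ^ 3 :=
    funext fun N => succ_mul_hsDiameter_pow_three σ N
  rw [h]
  exact tendsto_const_nhds

/-- **STUB `stub_transfer` of the line `einstein-elevator` (skeleton v1, registered on
stmt-AtomisticToContinuum-12504): the foreign near-equilibrium input around the elevator orbit and the dynamic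
near-atmosphere property of the guard class give the UNFLOORED short-time guarded hydrodynamic limit `S`.**
[folklore] -/
theorem stub_transfer : ElevatorOrbitHL → DynamicNearAtmosphere → ShortTimeGuardedHL := by
  rintro ⟨η₀E, hη₀E, HE⟩ ⟨η₁, hη₁, C, hC, a, HN⟩
  refine ⟨min η₀E η₁, lt_min hη₀E hη₁, fun M hM => ?_⟩
  by_cases hM1 : M < 1
  · -- the level-`M` guards are unsatisfiable: any horizon works
    refine ⟨1, one_pos, fun a₀ θ₀ u₀ _ _ _ _ _ => ⟨1, one_pos, ?_⟩⟩
    intro σ _ _ T ρ θ u _ Φ _ t ht hg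
    exact absurd (hg 0 ⟨le_rfl, ht.1⟩ (0 : T3)) (not_guardAt_of_lt_one hM hM1)
  rw [not_lt] at hM1
  -- `M ≥ 1`: the natural horizon `Θ := C Mᵃ + 1`, then `K, δ`, then `τ`
  have hCMa : 0 < C * M ^ a := by positivity
  set Θ : ℝ := C * M ^ a + 1 with hΘdef
  have hΘ : 0 < Θ := by positivity
  obtain ⟨K, hK, δ, hδ, HE1⟩ := HE M hM Θ hΘ
  have hK0 : 0 < K := by linarith
  obtain ⟨τ, hτ, HN1⟩ := HN M hM1 K hK δ hδ
  refine ⟨min τ (C * M ^ a / (4 * K)), lt_min hτ (by positivity), fun a₀ θ₀ u₀ ha hθ hu ha0 hθ0 => ?_⟩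
  obtain ⟨σ₀E, hσ₀E, HE2⟩ := HE1 a₀ θ₀ u₀ ha hθ hu ha0 hθ0
  refine ⟨min σ₀E (1 / 2), lt_min hσ₀E (by norm_num), fun σ hσ hσlt T ρ θ u hEul Φ h0 t ht hg => ?_⟩
  have hσE : σ < σ₀E := lt_of_lt_of_le hσlt (min_le_left _ _)
  have hσhalf : σ ≤ 1 / 2 := (lt_of_lt_of_le hσlt (min_le_right _ _)).le
  have hσ1 : σ ≤ 1 := hσhalf.trans (by norm_num)
  -- `t = 0` is the hypothesis itself
  rcases eq_or_lt_of_le ht.1 with h0t | htpos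
  · rw [← h0t]; exact h0
  have htT : t < T := lt_of_lt_of_le ht.2 (min_le_left _ _)
  have htτ : t ≤ τ := (lt_of_lt_of_le ht.2 ((min_le_right _ _).trans (min_le_left _ _))).le
  have ht4K : t ≤ C * M ^ a / (4 * K) :=
    (lt_of_lt_of_le ht.2 ((min_le_right _ _).trans (min_le_right _ _))).le
  -- the scale `ℓ₀ := t / (C Mᵃ)`
  set ℓ₀ : ℝ := t / (C * M ^ a) with hℓ₀def
  have hℓ₀ : 0 < ℓ₀ := div_pos htpos hCMa
  have hKℓ₀ : K * ℓ₀ ≤ 1 / 4 := by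
    rw [hℓ₀def, mul_div_assoc', div_le_iff₀ hCMa]
    rw [le_div_iff₀ (by positivity)] at ht4K
    linarith
  have hℓ₀1 : ℓ₀ ≤ 1 := by
    have : ℓ₀ ≤ K * ℓ₀ := le_mul_of_one_le_left hℓ₀.le hK
    linarith
  have htΘ : t < Θ * ℓ₀ := by
    have h1 : Θ * ℓ₀ = t + ℓ₀ := by
      rw [hΘdef, hℓ₀def]; field_simp
    rw [h1]; linarith
  -- the guards in the two packing bands
  have hgA : ∀ s ∈ Set.Icc 0 t, ∀ x, GuardAt η₁ M σ ρ θ u s x := by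
    intro s hs x
    obtain ⟨g1, g2⟩ := hg s hs x
    exact ⟨lt_of_lt_of_le g1 (min_le_right _ _), g2⟩
  have hgS : ∀ s ∈ Set.Icc 0 t, ∀ x, GuardAtScale η₀E M ℓ₀ σ ρ θ u s x := by
    intro s hs x
    obtain ⟨g1, g2⟩ := hg s hs x
    exact guardAtScale_of_guardAt hM.le hℓ₀ hℓ₀1 ⟨lt_of_lt_of_le g1 (min_le_left _ _), g2⟩
  -- steep ⇒ straight: the near-atmosphere hypothesis of `ElevatorOrbitHL` at scale `ℓ₀`
  have hnear : ∀ x₀ : T3, ∃ g : V3, ‖g‖ * ℓ₀ ≤ 1 ∧ NearAtmosphereOn (ρ 0) (θ 0) (u 0) x₀ g (K * ℓ₀) δ :=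
    HN1 σ T ρ θ u hσ hσ1 hEul t htpos htT htτ hgA
  -- the foreign input along the conjunct's own family `(hsDiameter σ N, N + 1)`
  have HE3 := HE2 σ hσ hσE (hsDiameter σ) (fun N => N + 1) (fun N => hsDiameter_pos hσ N)
    (tendsto_hsDiameter σ) (tendsto_succ_mul_hsDiameter_pow_three σ) T ρ θ u hEul ℓ₀ hℓ₀ hKℓ₀ hnear Φ
  have hP : ∀ N, IsProbabilityMeasure (localGibbsLaw σ a₀ u₀ θ₀ N (Φ N)) := fun N =>
    isProbabilityMeasure_localGibbsLaw ha hθ hu ha0 hθ0 hσhalf N (Φ N)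
  exact HE3 hP h0 t ⟨ht.1, lt_min htT htΘ⟩ hgS

end Summit.AtomisticToContinuum.HydrodynamicLimit.Theorems.ConeLocalisation.Elevator

end
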